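import Mathlib.LinearAlgebra.FreeModule.Finite.Matrix
import Literature.NumberTheory.DiophantineGeometry.AVIsogenyTate
import Literature.AlgebraicGeometry.Motives.FaltingsECIsogenyProofs
import HarnessLib

/-!
# Discharged fact: `T_ℓ f` is injective for an isogeny `f` of abelian varieties

Sibling proof file of `Literature/NumberTheory/DiophantineGeometry/AVIsogenyTate.lean`, which
records as a named fact

* `Literature.AlgebraicGeometry.Motives.AbelianVariety.tateModuleMap_injective_of_isIsogeny :
  Prop` — for abelian varieties `A, B` over a field `K`, an isogeny `f : A ⟶ B` and a prime `ℓ`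
  with `ℓ ≠ char K`, the induced map of Tate modules `T_ℓ f : T_ℓ A → T_ℓ B` is injective
  (Mumford, *Abelian Varieties*, §19, p. 172: `V_ℓ f` is an isomorphism for an isogeny `f`;
  Milne, *Abelian Varieties*, §§8, 12);

proved here as
`Literature.AlgebraicGeometry.Motives.AbelianVariety.tateModuleMap_injective_of_isIsogeny_holds`.
Users holding `(h : tateModuleMap_injective_of_isIsogeny)` discharge it with this theorem.

## Proof

An element of `T_ℓ A` is a sequence `(a_n)` of points of `A(K̄)` with `ℓ^n a_n = 0` and
`ℓ a_{n+1} = a_n` (Milne 1986, Remark 8.4; `Literature.NumberTheory.EllipticCurves.TateModule`),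
and `T_ℓ f (a_n) = (f a_n)`. If `T_ℓ f (a) = 0` then every `a_n` lies in the kernel of
`f : A(K̄) → B(K̄)`, which is **finite** because an isogeny is a finite morphism
(Milne 1986, §8: an isogeny is a surjective homomorphism with finite kernel, equivalently finite,
flat and surjective, Prop. 8.1): the tree already knows that `T_ℓ` of an additive map with finite
kernel is injective (`Literature.NumberTheory.EllipticCurves.TateModule.map_injective_of_finite_ker`,
file `Literature/AlgebraicGeometry/Motives/FaltingsECIsogenyProofs.lean` — the components of an
element of the kernel have unbounded order unless they all vanish), so it remains to prove the
finiteness of `ker (A(K̄) → B(K̄))`, which we do in two scheme-theoretic steps valid for any finite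
morphism:

1. `finite_sections_of_isFinite`: a scheme `P` finite over `Spec L` (`L` a field) has finitely
   many sections `Spec L → P`: `P = Spec R` is affine with `R` a finite `L`-algebra
   (Mathlib `HasAffineProperty IsFinite`), a section is determined by the `L`-algebra map
   `R → L` it induces on global sections (Mathlib `ext_of_isAffine`), and `Hom_L(R, L)` is finite
   (Mathlib `Finite.algHom`, linear independence of characters).
2. `finite_specHom_comp_eq_of_isFinite`: hence a finite morphism `f : X → Y` has finitely many
   `L`-points in the fibre over any `L`-point `y : Spec L → Y` (lift `x` with `x ≫ f = y` to a
   section of the base change `X ×_Y Spec L → Spec L`, which is finite).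

Applied to the underlying morphism of schemes of `f` and the unit point of `B(K̄)` this gives
`IsIsogeny.finite_ker_geomPointsMap`, and the discharge follows. The hypothesis `ℓ ≠ char K` of
the named fact is not used: `T_ℓ f` is injective for every prime `ℓ`
(`IsIsogeny.tateModuleMap_injective`), the kernel of an isogeny being finite in every
characteristic; the fact is kept as printed-and-vendored (it is the weaker statement).

## Design notes

* Nothing here is a new named fact; every declaration is proved (D-0026).
* The exact count `#Ker f (L) = rank (Ker f)` for `f` finite *étale* is
  `Literature.AlgebraicGeometry.Motives.AbelianVariety.natCard_kerPoints_eq_kerRank`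
  (`AbelianVarietyTorsion.lean`); here only finiteness is needed, for an arbitrary finite `f`
  (e.g. `[p]` in characteristic `p`), so we argue directly from Mathlib's `IsFinite` and do not
  import the kernel-scheme / Hopf-algebra files.
* Mathlib searched and used: `IsFinite` and its `HasAffineProperty` instance,
  `isAffine_of_isAffineHom`, `ext_of_isAffine`, `Scheme.ΓSpecIso`, `Finite.algHom`,
  `pullback.lift_fst/snd`, `MorphismProperty.pullback_snd`; Mathlib has
  `Scheme.Hom.finite_preimage_singleton` (finite fibres as *sets of points*) but no statement
  about `L`-valued points of a fibre, and no Tate modules of abelian varieties.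

## References

* D. Mumford, *Abelian Varieties*, TIFR Studies in Math. 5, Oxford Univ. Press (1970; 2nd ed.
  1974), §19, p. 172 (for an isogeny `f`, `V_ℓ f` is an isomorphism; via the quasi-inverse of the
  Remark p. 169) and Thm. 3. The book is not held by the literature store (acquisition requested);
  locator as vendored in `AVIsogenyTate.lean`. [MumfordAV1970]
* J. S. Milne, *Abelian Varieties*, Ch. V of Cornell–Silverman (eds.), *Arithmetic Geometry*,
  Springer (1986): §8 (isogenies, Prop. 8.1; Remark 8.4, `T_ℓ A` as compatible sequences, PDF
  p. 182), §12 (Lemma 12.6, Thm. 12.5). [Milne1986AbelianVarieties]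
-/

universe u

open CategoryTheory AlgebraicGeometry

noncomputable section

namespace Literature.NumberTheory.DiophantineGeometry

/-! ### Finite morphisms have finitely many `L`-valued points in each `L`-fibre -/

section FiniteMorphisms

/-- **A scheme finite over a field has finitely many sections.** If `q : P → Spec L` is a finite
morphism (`L` a field), the set of sections `s : Spec L → P`, `s ≫ q = 𝟙`, is finite. Proof:
`P` is affine (a finite morphism is affine) with `R = Γ(P, 𝒪_P)` a finite `L`-algebra; a section
is determined by the induced `L`-algebra map `R → Γ(Spec L) ≅ L` (morphisms into an affine scheme
are determined by their effect on global sections, Mathlib `ext_of_isAffine`), and there are only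
finitely many `L`-algebra maps `R → L` (Mathlib `Finite.algHom`: distinct characters are linearly
independent). Standard (EGA I, 3.4; Görtz–Wedhorn I, Prop. 3.4 and §5: `X(L) = Hom_L(R, L)` for
affine `X = Spec R`). [folklore] -/
theorem finite_sections_of_isFinite {L : Type u} [Field L] {P : Scheme.{u}}
    (q : P ⟶ Spec (.of L)) (hqf : IsFinite q) :
    Finite {s : Spec (.of L) ⟶ P // s ≫ q = 𝟙 _} := by
  have hP : IsAffine P := isAffine_of_isAffineHom q
  have hq : RingHom.Finite q.appTop.hom :=
    ((HasAffineProperty.iff_of_isAffine (P := @IsFinite)).mp hqf).2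
  set ι := Scheme.ΓSpecIso (CommRingCat.of L)
  -- `Γ(P, 𝒪)` as a finite `L`-algebra through `L ≅ Γ(Spec L) → Γ(P)`
  let ψ : L →+* Γ(P, ⊤) := q.appTop.hom.comp ι.inv.hom
  have hψ : ψ.Finite :=
    hq.comp (.of_surjective _ fun y => ⟨ι.hom y, by simp [ι]⟩)
  letI : Algebra L Γ(P, ⊤) := ψ.toAlgebra
  haveI : Module.Finite L Γ(P, ⊤) := hψ
  -- a section `s` gives the `L`-algebra map `Γ(P) → Γ(Spec L) ≅ L`
  let χ : {s : Spec (.of L) ⟶ P // s ≫ q = 𝟙 _} → (Γ(P, ⊤) →ₐ[L] L) := fun s =>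
    { ι.hom.hom.comp s.1.appTop.hom with
      commutes' := fun x => by
        change ι.hom (s.1.appTop (q.appTop (ι.inv x))) = x
        rw [← CategoryTheory.comp_apply (q.appTop), ← Scheme.Hom.comp_appTop, s.2,
          Scheme.Hom.id_appTop]
        simp [ι] }
  -- which determines `s`, the target `P` being affine
  refine Finite.of_injective χ fun s t hst => Subtype.ext (ext_of_isAffine ?_)
  ext x
  have hx : ι.hom (s.1.appTop x) = ι.hom (t.1.appTop x) := DFunLike.congr_fun hst x
  simpa [ι] using congrArg ι.inv hx

/-- **Finite morphisms have finitely many `L`-points in each `L`-fibre.** If `f : X → Y` is a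
finite morphism of schemes, `L` a field and `y : Spec L → Y`, then there are only finitely many
`x : Spec L → X` with `x ≫ f = y`: such an `x` is the same as a section of the base change
`X ×_Y Spec L → Spec L` (universal property of the fibre product), which is again finite, so
`finite_sections_of_isFinite` applies. (The fibre `X ×_Y Spec L` is the spectrum of a finite
`L`-algebra; EGA I, 3.4 and II, 6.1; Görtz–Wedhorn I, §5 and Prop. 12.11.) [folklore] -/
theorem finite_specHom_comp_eq_of_isFinite {L : Type u} [Field L] {X Y : Scheme.{u}} (f : X ⟶ Y)
    (hf : IsFinite f) (y : Spec (.of L) ⟶ Y) :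
    Finite {x : Spec (.of L) ⟶ X // x ≫ f = y} := by
  have hfin := finite_sections_of_isFinite (Limits.pullback.snd f y) inferInstance
  refine @Finite.of_injective _ _ hfin
    (fun x => ⟨Limits.pullback.lift x.1 (𝟙 _) (by rw [x.2, Category.id_comp]),
      Limits.pullback.lift_snd _ _ _⟩) fun x x' hxx' => Subtype.ext ?_
  have h := congrArg
    (fun s : {s // s ≫ Limits.pullback.snd f y = 𝟙 _} => s.1 ≫ Limits.pullback.fst f y) hxx'
  simpa [Limits.pullback.lift_fst] using h

end FiniteMorphisms

/-! ### The kernel of an isogeny on geometric points is finite; discharge -/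

section AbelianVariety
open Literature.AlgebraicGeometry.Motives (AbelianVariety)
open Literature.AlgebraicGeometry.Motives.AbelianVariety
open Literature.AlgebraicGeometry.Motives.AbelianVariety.Hom

variable {K : Type u} [Field K] {A B : AbelianVariety K}

/-- **The kernel of an isogeny on geometric points is finite**: for an isogeny `f : A ⟶ B` of
abelian varieties over `K`, the kernel of `geomPointsMap f : A(K̄) →+ B(K̄)` is a finite group.
Indeed it injects (`P ↦` its underlying morphism `Spec K̄ → A`) into the set of `K̄`-points of
`A` lying over the unit point of `B(K̄)` for the finite morphism underlying `f`, which is finite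
by `finite_specHom_comp_eq_of_isFinite`. Milne, *Abelian Varieties* (1986), §8: an isogeny is a
surjective homomorphism with finite kernel, equivalently a finite flat surjective one
(Prop. 8.1); Mumford §19 uses the finiteness of `ker f` on points throughout (pp. 169–172).
[cite: Milne1986AbelianVarieties, §8 Prop. 8.1] -/
theorem _root_.Literature.AlgebraicGeometry.Motives.AbelianVariety.IsIsogeny.finite_ker_geomPointsMap
    {f : A ⟶ B} (hf : IsIsogeny f) : Finite (geomPointsMap f).ker := by
  -- the unit point `e ∈ B(K̄)` and the finite set of `K̄`-points of `A` over it
  let e : B.Points (AlgebraicClosure K) := 1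
  have hfin := finite_specHom_comp_eq_of_isFinite (Hom.toSchemeHom f) hf.2 e.left
  have key : ∀ P : (geomPointsMap f).ker,
      (Additive.toMul (P : A.geomPoints)).left ≫ Hom.toSchemeHom f = e.left := by
    intro P
    have hP : geomPointsMap f P = 0 := P.2
    have hP' : Additive.toMul (P : A.geomPoints) ≫ f.hom.hom.hom = e := by
      have h := congrArg Additive.toMul hP
      rwa [geomPointsMap_apply, Literature.AlgebraicGeometry.Motives.AlgPoints.map_apply] at h
    rw [← hP']
    rfl
  -- a point over `K` is determined by its underlying morphism of schemes
  exact @Finite.of_injective _ _ hfin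
    (fun P => ⟨(Additive.toMul (P : A.geomPoints)).left, key P⟩)
    fun P Q hPQ => Subtype.ext (Additive.toMul.injective
      (Over.OverMorphism.ext (congrArg Subtype.val hPQ)))

/-- **`T_ℓ f` is injective for an isogeny `f`, for every prime `ℓ`** (no restriction on the
characteristic): if `T_ℓ f (a) = 0` then all components `a_n ∈ A[ℓ^n](K̄)` of `a` lie in the
finite group `ker (A(K̄) → B(K̄))` (`IsIsogeny.finite_ker_geomPointsMap`), and `T_ℓ` of an additive
map with finite kernel is injective
(`Literature.NumberTheory.EllipticCurves.TateModule.map_injective_of_finite_ker`). This is the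
injectivity half of "for an isogeny `f`, `V_ℓ f : V_ℓ A → V_ℓ B` is an isomorphism", Mumford,
*Abelian Varieties*, §19, p. 172 (there via the quasi-inverse `g`, `g ∘ f = [n]`, Remark p. 169);
cf. Milne 1986, Remark 8.4 and Lemma 12.6. [cite: MumfordAV1970, §19 p. 172] -/
theorem _root_.Literature.AlgebraicGeometry.Motives.AbelianVariety.IsIsogeny.tateModuleMap_injective
    {f : A ⟶ B} (hf : IsIsogeny f) (ℓ : ℕ) [Fact ℓ.Prime] :
    Function.Injective (tateModuleMap ℓ f) :=
  haveI := hf.finite_ker_geomPointsMap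
  Literature.NumberTheory.EllipticCurves.TateModule.map_injective_of_finite_ker (p := ℓ)
    (geomPointsMap f) (Set.toFinite _)

/-- **Discharge of the named fact `tateModuleMap_injective_of_isIsogeny`** (Mumford, *Abelian
Varieties*, §19, p. 172; Milne, *Abelian Varieties*, §§8, 12): for an isogeny `f : A ⟶ B` of
abelian varieties over a field `K` and a prime `ℓ ≠ char K`, the map `T_ℓ f : T_ℓ A → T_ℓ B` of
`ℓ`-adic Tate modules is injective — its kernel consists of compatible sequences of points of the
finite group `ker (A(K̄) → B(K̄))`, which must vanish. Specialisation of
`IsIsogeny.tateModuleMap_injective` (the hypothesis `ℓ ≠ char K` of the vendored statement is not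
needed for injectivity). [cite: MumfordAV1970, §19 p. 172] -/
theorem _root_.Literature.AlgebraicGeometry.Motives.AbelianVariety.tateModuleMap_injective_of_isIsogeny_holds :
    tateModuleMap_injective_of_isIsogeny (A := A) (B := B) :=
  fun hf ℓ _ _ => hf.tateModuleMap_injective ℓ

end AbelianVariety

end Literature.NumberTheory.DiophantineGeometry
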